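import Summits.NavierStokesRegularity.NavierStokesRegularity.Theses.QuantisedSymmetry
import Summits.NavierStokesRegularity.NavierStokesRegularity.Theorems.QuantisedSymmetryLiouvilleKillsProfile

/-!
# Strategist s8 sketch — typed decomposition attempt for `PolyhedralDssProfileExists`
(crux stmt-NavierStokesRegularity-1404, route QuantisedSymmetry; census family `s`).

Nothing in this file is filed as an item. These are the signatures quoted in
`STRATEGY-CENSUS-s8.md` § Decomposition (the "D-split": existence half / periodicity half),
with the kernel-checked seam and the proof that BOTH halves are consequences of the crux.
-/

namespace Summit.NavierStokesRegularity.NavierStokesRegularity.Cruxes.PolyhedralDssProfileExists.S8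

open Summit.NavierStokesRegularity.NavierStokesRegularity.Theses.QuantisedSymmetry

/-- D2 (existence half): the polyhedral Type-I Liouville theorem (route item #3, stmt-1405) FAILS —
some finite irreducible proper rotation group `G` admits a bounded ancient mild solution with
Type-I space–time decay, `G`-equivariant about the origin, not a.e. zero on some slice.
No periodicity / self-similarity is asked. -/
def PolyhedralTypeIAncientExists : Prop := ¬ PolyhedralTypeILiouville

/-- D1 (periodicity half): the recurrence-to-periodicity upgrade — from SOME nontrivial polyhedral
Type-I ancient solution to a DISCRETELY SELF-SIMILAR one. -/
def PeriodicUpgrade : Prop := PolyhedralTypeIAncientExists → PolyhedralDssProfileExists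

/-- Seam of the D-split (modus ponens; flag `trivial_seam`). -/
theorem crux_of_D (h1 : PeriodicUpgrade) (h2 : PolyhedralTypeIAncientExists) :
    PolyhedralDssProfileExists := h1 h2

/-- D2 is a PROVED consequence of the crux: contrapositive of the landed kill-switch glue
`LiouvilleKillsProfile` (stmt-1408, `quantisedSymmetry_liouvilleKillsProfile_proof`). -/
theorem D2_of_crux (h : PolyhedralDssProfileExists) : PolyhedralTypeIAncientExists :=
  fun hL => _root_.Summit.NavierStokesRegularity.NavierStokesRegularity.Theorems.quantisedSymmetry_liouvilleKillsProfile_proof hL h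

/-- … hence D1 is implied by the crux as well (both halves are necessary conditions). -/
theorem D1_of_crux (h : PolyhedralDssProfileExists) : PeriodicUpgrade := fun _ => h

/-- The split is exact: crux ↔ D1 ∧ D2. -/
theorem crux_iff_D : PolyhedralDssProfileExists ↔ (PeriodicUpgrade ∧ PolyhedralTypeIAncientExists) :=
  ⟨fun h => ⟨D1_of_crux h, D2_of_crux h⟩, fun h => crux_of_D h.1 h.2⟩

end Summit.NavierStokesRegularity.NavierStokesRegularity.Cruxes.PolyhedralDssProfileExists.S8
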